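import Mathlib.Analysis.SpecialFunctions.Complex.Circle
import Mathlib.Topology.ContinuousMap.Basic
import HarnessLib

/-!
# Interpolating two isotopies across a shell: the geometric monodromy which is the MODEL inside a ball and the
# IDENTITY outside it

General topology; theorems only (no definition, no named fact). The last assembly step of the classical construction
of the geometric monodromy of an isolated singularity (Arnold–Gusein-Zade–Varchenko II §1.1: "the monodromy `h` […]
is the identity near the boundary of the ball"; Milnor §9 for the model inside), in the form used by the programme
"localisation of the nodal meridian monodromy" (crux K1 of
`Summits/HodgeConjecture/HodgeConjecture/Theses/CyclicUnitaryPowers.lean`).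

Data on a space `M` with continuous `p : M → ℂ` (base coordinate) and `ρ : M → ℝ` (squared radius in a Morse
chart, extended by a large constant far away): an INSIDE isotopy `J : ℝ × M → M` (written `I` in the formulas below) defined on the ball `{ρ < R}`
(continuous there, preserving `ρ`, covering the rotation `p (I(θ,x)) = e^{iθ} p x`, a flow with `I(0,·) = id` — the
weighted rotation in the Morse chart, `PhamBrieskornWeightedRotation`), an OUTSIDE isotopy `g : ℝ × M → M`
(continuous, `g(0,·) = g(2π,·) = id`, and on `{s₀ < ρ}` over the disc `‖p‖ < δ`: staying in `{s₀ < ρ}`, covering the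
rotation, a flow, preserving `ρ` below `R` — the fold isotopy of `DiscFoldRotationIsotopy`), radii
`s₀ ≤ s₁ < s₂ < R' < R`, and a continuous cut-off `λ : ℝ → ℝ` with `λ = 0` on `(−∞, s₁]` and `λ = 1` on `[s₂, ∞)`.
The INTERPOLATED isotopy is

  `h(u, x) = g(2πu·λ(ρ x), I(2πu·(1 − λ(ρ x)), x))` if `ρ x ≤ R'`,  `h(u, x) = g(2πu, x)` otherwise

(first turn by the model by the fraction `1 − λ` of the angle, then by the outside isotopy by the fraction `λ`; the
total angle is `2πu`). Results:

* `continuous_shellIsotopy` — `h` is continuous on `ℝ × M`;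
* `shellIsotopy_zero`, `apply_p_shellIsotopy`, `apply_ρ_shellIsotopy` — `h(0,·) = id`; over the disc `h(u,·)` covers
  the rotation by `2πu` and preserves `ρ` below `R`;
* `shellIsotopy_one_of_le`, `shellIsotopy_one_of_ge` — **`h(1, x) = I(2π, x)` (the model monodromy) for `ρ x ≤ s₁`
  and `h(1, x) = x` for `ρ x ≥ s₂`**;
* `shellIsotopy_leftInverse`, `shellIsotopy_rightInverse` — the explicit inverse `k(u, ·)` (same shape, negative
  angles), so each `h(u, ·)` is a homeomorphism between fibres over the disc;
* `continuousOn_shellHomotopy`, `shellHomotopy_*` — the homotopy `H(s, x) = g(2πsλ(ρx), I(2π(1 − sλ(ρx)), x))`,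
  `s ∈ [0, 1]`, through self-maps of each fibre-ball `{p = c, ρ < R'}`, from `I(2π, ·)` (`s = 0`) to `h(1, ·)` (`s = 1`)
  — the input "`h|_A` is homotopic to the model through maps `A → A`" of `PhamBrieskornCyclicNodeLocalisationHomotopy`.

## References

* [ArnoldGuseinzadeVarchenko2012] V. I. Arnold, S. M. Gusein-Zade, A. N. Varchenko, Singularities of Differentiable Maps,
  Vol. 2, Part I §1.1 (held text p0013, p0025).
* [Milnor1968] J. Milnor, Singular Points of Complex Hypersurfaces, §9 Lemma 9.4.
-/

noncomputable section

open Set Function Complex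
open scoped Real

namespace Literature.Geometry.Manifold

section Shell

variable {M : Type*} {p : M → ℂ} {ρ : M → ℝ} {J g : ℝ × M → M} {lam : ℝ → ℝ} {s₀ s₁ s₂ R' R δ : ℝ}

/-- The rotation `e^{iθ}c` composes additively in the angle. [folklore] -/
private theorem exp_mul_I_add_mul (a b : ℝ) (c : ℂ) :
    Complex.exp ((a : ℂ) * I) * (Complex.exp ((b : ℂ) * I) * c) = Complex.exp (((a + b : ℝ) : ℂ) * I) * c := by
  rw [← mul_assoc, ← Complex.exp_add]; congr 1; push_cast; ring

/-- `‖e^{iθ} c‖ = ‖c‖`. [folklore] -/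
private theorem norm_exp_mul_I_mul (a : ℝ) (c : ℂ) : ‖Complex.exp ((a : ℂ) * I) * c‖ = ‖c‖ := by
  rw [norm_mul, Complex.norm_exp_ofReal_mul_I, one_mul]

/-! ### Consequences of the hypotheses on `g`: the region `{ρ ≥ R}` is invariant too -/

/-- If the outside isotopy preserves the levels of `ρ` below `R` (on `{s₀ < ρ}` over the disc) and is a flow there,
then it cannot bring a point from `{ρ ≥ R}` below `R` (apply level preservation to the way back).
[cite: ArnoldGuseinzadeVarchenko2012, Part I §1.1 (held text p0025)] -/
theorem le_ρ_outside_of_le (hs₀R : s₀ < R)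
    (hgO : ∀ θ q, s₀ < ρ q → ‖p q‖ < δ → s₀ < ρ (g (θ, q)) ∧ p (g (θ, q)) = Complex.exp ((θ : ℂ) * I) * p q)
    (hgadd : ∀ θ θ' q, s₀ < ρ q → ‖p q‖ < δ → g (θ + θ', q) = g (θ, g (θ', q)))
    (hg0 : ∀ q, g (0, q) = q)
    (hgρ : ∀ θ q, s₀ < ρ q → ‖p q‖ < δ → ρ q < R → ρ (g (θ, q)) = ρ q)
    {q : M} (hq : ‖p q‖ < δ) (hR : R ≤ ρ q) (θ : ℝ) : R ≤ ρ (g (θ, q)) := by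
  by_contra hlt
  have hlt : ρ (g (θ, q)) < R := not_le.1 hlt
  have hqO : s₀ < ρ q := hs₀R.trans_le hR
  obtain ⟨hO', hp'⟩ := hgO θ q hqO hq
  have hq' : ‖p (g (θ, q))‖ < δ := by rw [hp', norm_exp_mul_I_mul]; exact hq
  have h := hgρ (-θ) (g (θ, q)) hO' hq' hlt
  rw [← hgadd (-θ) θ q hqO hq, neg_add_cancel, hg0] at h
  exact absurd (h ▸ hlt) (not_lt.2 hR)

/-! ### The interpolated isotopy -/

/-- **Continuity of the interpolated isotopy** `h(u, x) = g(2πuλ(ρx), I(2πu(1−λ(ρx)), x))` for `ρ x ≤ R'`,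
`g(2πu, x)` otherwise: the two branches are continuous on the closed pieces `{ρ ≤ R'}` (inside the ball `{ρ < R}` where
`I` is continuous) and `{ρ ≥ R'}`, and agree on `{ρ = R'}` because `λ = 1` there (`R' ≥ s₂`) and `I(0, ·) = id`.
[cite: ArnoldGuseinzadeVarchenko2012, Part I §1.1 (held text p0013)] -/
theorem continuous_shellIsotopy [TopologicalSpace M] (hp : Continuous ρ) (hs₂R' : s₂ ≤ R') (hR'R : R' < R)
    (hlam : Continuous lam) (hlam₁ : ∀ t, s₂ ≤ t → lam t = 1)
    (hIcont : ContinuousOn J (univ ×ˢ {x | ρ x < R})) (hI0 : ∀ x, ρ x < R → J (0, x) = x)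
    (hgcont : Continuous g) :
    Continuous fun ux : ℝ × M => if ρ ux.2 ≤ R' then
      g (2 * π * ux.1 * lam (ρ ux.2), J (2 * π * ux.1 * (1 - lam (ρ ux.2)), ux.2)) else g (2 * π * ux.1, ux.2) := by
  refine continuous_if_le (hp.comp continuous_snd) continuous_const ?_ ?_ ?_
  · -- inside branch, on `{ρ ≤ R'} ⊆ {ρ < R}`
    have hang₁ : Continuous fun ux : ℝ × M => 2 * π * ux.1 * lam (ρ ux.2) :=
      (continuous_const.mul continuous_fst).mul (hlam.comp (hp.comp continuous_snd))
    have hang₂ : Continuous fun ux : ℝ × M => 2 * π * ux.1 * (1 - lam (ρ ux.2)) :=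
      (continuous_const.mul continuous_fst).mul (continuous_const.sub (hlam.comp (hp.comp continuous_snd)))
    have hIin : ContinuousOn (fun ux : ℝ × M => J (2 * π * ux.1 * (1 - lam (ρ ux.2)), ux.2))
        {ux : ℝ × M | ρ ux.2 ≤ R'} :=
      hIcont.comp (hang₂.continuousOn.prodMk continuousOn_snd) fun ux hux =>
        ⟨mem_univ _, lt_of_le_of_lt hux hR'R⟩
    exact hgcont.comp_continuousOn (hang₁.continuousOn.prodMk hIin)
  · exact (hgcont.comp ((continuous_const.mul continuous_fst).prodMk continuous_snd)).continuousOn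
  · rintro ⟨u, x⟩ hx
    simp only at hx ⊢
    rw [hlam₁ _ (hs₂R'.trans hx.ge), mul_one, sub_self, mul_zero, hI0 x (hx ▸ hR'R)]

/-- **`h(0, ·) = id`.** [cite: ArnoldGuseinzadeVarchenko2012, Part I §1.1 (held text p0013)] -/
theorem shellIsotopy_zero (hR'R : R' < R) (hI0 : ∀ x, ρ x < R → J (0, x) = x) (hg0 : ∀ q, g (0, q) = q) (x : M) :
    (if ρ x ≤ R' then g (2 * π * (0 : ℝ) * lam (ρ x), J (2 * π * (0 : ℝ) * (1 - lam (ρ x)), x))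
      else g (2 * π * (0 : ℝ), x)) = x := by
  split_ifs with hx
  · rw [mul_zero, zero_mul, zero_mul, hI0 x (lt_of_le_of_lt hx hR'R), hg0]
  · rw [mul_zero, hg0]

/-- **Over the disc `h(u, ·)` covers the rotation by `2πu` and preserves `ρ` below `R`; above `R'` it stays above
`R'`.** [cite: ArnoldGuseinzadeVarchenko2012, Part I §1.1 (held text p0013, p0025)] -/
theorem apply_shellIsotopy (hs₀₁ : s₀ ≤ s₁) (hs₁₂ : s₁ < s₂) (hs₂R' : s₂ ≤ R') (hR'R : R' < R)
    (hlam₀ : ∀ t, t ≤ s₁ → lam t = 0)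
    (hI : ∀ θ x, ρ x < R → ρ (J (θ, x)) = ρ x ∧ p (J (θ, x)) = Complex.exp ((θ : ℂ) * I) * p x)
    (hg0 : ∀ q, g (0, q) = q)
    (hgO : ∀ θ q, s₀ < ρ q → ‖p q‖ < δ → s₀ < ρ (g (θ, q)) ∧ p (g (θ, q)) = Complex.exp ((θ : ℂ) * I) * p q)
    (hgadd : ∀ θ θ' q, s₀ < ρ q → ‖p q‖ < δ → g (θ + θ', q) = g (θ, g (θ', q)))
    (hgρ : ∀ θ q, s₀ < ρ q → ‖p q‖ < δ → ρ q < R → ρ (g (θ, q)) = ρ q)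
    (u : ℝ) {x : M} (hx : ‖p x‖ < δ) :
    p (if ρ x ≤ R' then g (2 * π * u * lam (ρ x), J (2 * π * u * (1 - lam (ρ x)), x)) else g (2 * π * u, x)) =
        Complex.exp (((2 * π * u : ℝ) : ℂ) * I) * p x ∧
      (ρ x < R → ρ (if ρ x ≤ R' then g (2 * π * u * lam (ρ x), J (2 * π * u * (1 - lam (ρ x)), x))
        else g (2 * π * u, x)) = ρ x) ∧
      (R' < ρ x → R' < ρ (if ρ x ≤ R' then g (2 * π * u * lam (ρ x), J (2 * π * u * (1 - lam (ρ x)), x))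
        else g (2 * π * u, x))) := by
  have hs₀R : s₀ < R := by linarith
  split_ifs with hxR'
  · have hxR : ρ x < R := lt_of_le_of_lt hxR' hR'R
    obtain ⟨hρy, hpy⟩ := hI (2 * π * u * (1 - lam (ρ x))) x hxR
    set y := J (2 * π * u * (1 - lam (ρ x)), x) with hy
    by_cases hx₁ : ρ x ≤ s₁
    · -- deep inside: `λ = 0`, no outside turn
      rw [hlam₀ _ hx₁, mul_zero, hg0, sub_zero, mul_one] at *
      exact ⟨hpy, fun _ => hρy, fun h => absurd (hx₁.trans_lt (hs₁₂.trans_le hs₂R')) (not_lt.2 h.le)⟩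
    · have hx₁ : s₁ < ρ x := not_le.1 hx₁
      have hyO : s₀ < ρ y := by rw [hρy]; exact hs₀₁.trans_lt hx₁
      have hpy' : ‖p y‖ < δ := by rw [hpy, norm_exp_mul_I_mul]; exact hx
      obtain ⟨-, hpg⟩ := hgO (2 * π * u * lam (ρ x)) y hyO hpy'
      have hρg := hgρ (2 * π * u * lam (ρ x)) y hyO hpy' (hρy ▸ hxR)
      refine ⟨?_, fun _ => hρg.trans hρy, fun h => absurd hxR' (not_le.2 h)⟩
      rw [hpg, hpy, exp_mul_I_add_mul]
      congr 3
      ring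
  · have hxR' : R' < ρ x := not_le.1 hxR'
    have hxO : s₀ < ρ x := by linarith
    obtain ⟨-, hpg⟩ := hgO (2 * π * u) x hxO hx
    refine ⟨hpg, fun hxR => hgρ _ x hxO hx hxR, fun _ => ?_⟩
    by_cases hxR : ρ x < R
    · rw [hgρ _ x hxO hx hxR]; exact hxR'
    · exact lt_of_lt_of_le hR'R (le_ρ_outside_of_le hs₀R hgO hgadd hg0 hgρ hx (not_lt.1 hxR) _)

/-- **At `u = 1`, deep inside the ball (`ρ x ≤ s₁`) the interpolated isotopy is the MODEL MONODROMY `I(2π, ·)`.**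
[cite: Milnor1968, §9 Lemma 9.4] [cite: ArnoldGuseinzadeVarchenko2012, Part I §1.1 (held text p0013)] -/
theorem shellIsotopy_one_of_le (hs₁R' : s₁ ≤ R') (hlam₀ : ∀ t, t ≤ s₁ → lam t = 0) (hg0 : ∀ q, g (0, q) = q)
    {x : M} (hx : ρ x ≤ s₁) :
    (if ρ x ≤ R' then g (2 * π * (1 : ℝ) * lam (ρ x), J (2 * π * (1 : ℝ) * (1 - lam (ρ x)), x))
      else g (2 * π * (1 : ℝ), x)) = J (2 * π, x) := by
  rw [if_pos (hx.trans hs₁R'), hlam₀ _ hx, mul_zero, hg0, sub_zero, mul_one, mul_one]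

/-- **At `u = 1`, outside (`ρ x ≥ s₂`) the interpolated isotopy is the IDENTITY.**
[cite: ArnoldGuseinzadeVarchenko2012, Part I §1.1 (held text p0013, p0025)] -/
theorem shellIsotopy_one_of_ge (hR'R : R' < R) (hlam₁ : ∀ t, s₂ ≤ t → lam t = 1)
    (hI0 : ∀ x, ρ x < R → J (0, x) = x) (hg2π : ∀ q, g (2 * π, q) = q) {x : M} (hx : s₂ ≤ ρ x) :
    (if ρ x ≤ R' then g (2 * π * (1 : ℝ) * lam (ρ x), J (2 * π * (1 : ℝ) * (1 - lam (ρ x)), x))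
      else g (2 * π * (1 : ℝ), x)) = x := by
  split_ifs with hxR'
  · rw [hlam₁ _ hx, mul_one, mul_one, sub_self, mul_zero, hI0 x (lt_of_le_of_lt hxR' hR'R), hg2π]
  · rw [mul_one, hg2π]

/-- **The inverse of `h(u, ·)`**: `k(u, x') = I(−2πu(1−λ(ρx')), g(−2πuλ(ρx'), x'))` for `ρ x' ≤ R'`, `g(−2πu, x')`
otherwise, satisfies `k(u, h(u, x)) = x` over the disc. [cite: ArnoldGuseinzadeVarchenko2012, Part I §1.1 (held text p0013)] -/
theorem shellIsotopy_leftInverse (hs₀₁ : s₀ ≤ s₁) (hs₁₂ : s₁ < s₂) (hs₂R' : s₂ ≤ R') (hR'R : R' < R)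
    (hlam₀ : ∀ t, t ≤ s₁ → lam t = 0)
    (hI : ∀ θ x, ρ x < R → ρ (J (θ, x)) = ρ x ∧ p (J (θ, x)) = Complex.exp ((θ : ℂ) * I) * p x)
    (hI0 : ∀ x, ρ x < R → J (0, x) = x) (hIadd : ∀ θ θ' x, ρ x < R → J (θ + θ', x) = J (θ, J (θ', x)))
    (hg0 : ∀ q, g (0, q) = q)
    (hgO : ∀ θ q, s₀ < ρ q → ‖p q‖ < δ → s₀ < ρ (g (θ, q)) ∧ p (g (θ, q)) = Complex.exp ((θ : ℂ) * I) * p q)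
    (hgadd : ∀ θ θ' q, s₀ < ρ q → ‖p q‖ < δ → g (θ + θ', q) = g (θ, g (θ', q)))
    (hgρ : ∀ θ q, s₀ < ρ q → ‖p q‖ < δ → ρ q < R → ρ (g (θ, q)) = ρ q)
    (u : ℝ) {x : M} (hx : ‖p x‖ < δ) :
    (fun x' : M => if ρ x' ≤ R' then
        J (-(2 * π * u * (1 - lam (ρ x'))), g (-(2 * π * u * lam (ρ x')), x')) else g (-(2 * π * u), x'))
      (if ρ x ≤ R' then g (2 * π * u * lam (ρ x), J (2 * π * u * (1 - lam (ρ x)), x)) else g (2 * π * u, x)) = x := by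
  have hs₀R : s₀ < R := by linarith
  obtain ⟨-, hρ, hρ'⟩ := apply_shellIsotopy hs₀₁ hs₁₂ hs₂R' hR'R hlam₀ hI hg0 hgO hgadd hgρ u hx
  by_cases hxR' : ρ x ≤ R'
  · have hxR : ρ x < R := lt_of_le_of_lt hxR' hR'R
    rw [if_pos hxR'] at hρ ⊢
    have hρ := hρ hxR
    dsimp only
    rw [if_pos (hρ.le.trans hxR'), hρ]
    obtain ⟨hρy, hpy⟩ := hI (2 * π * u * (1 - lam (ρ x))) x hxR
    by_cases hx₁ : ρ x ≤ s₁
    · rw [hlam₀ _ hx₁, mul_zero, neg_zero, hg0, hg0, sub_zero, ← hIadd _ _ x hxR, neg_add_cancel, hI0 x hxR]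
    · have hx₁ : s₁ < ρ x := not_le.1 hx₁
      have hyO : s₀ < ρ (J (2 * π * u * (1 - lam (ρ x)), x)) := by rw [hρy]; exact hs₀₁.trans_lt hx₁
      have hpy' : ‖p (J (2 * π * u * (1 - lam (ρ x)), x))‖ < δ := by rw [hpy, norm_exp_mul_I_mul]; exact hx
      rw [← hgadd _ _ _ hyO hpy', neg_add_cancel, hg0, ← hIadd _ _ x hxR, neg_add_cancel, hI0 x hxR]
  · rw [if_neg hxR'] at hρ' ⊢
    have hxR' : R' < ρ x := not_le.1 hxR'
    have hxO : s₀ < ρ x := by linarith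
    dsimp only
    rw [if_neg (not_le.2 (hρ' hxR')), ← hgadd _ _ x hxO hx, neg_add_cancel, hg0]

/-- **… and `h(u, k(u, x')) = x'`** over the disc. [cite: ArnoldGuseinzadeVarchenko2012, Part I §1.1 (held text p0013)] -/
theorem shellIsotopy_rightInverse (hs₀₁ : s₀ ≤ s₁) (hs₁₂ : s₁ < s₂) (hs₂R' : s₂ ≤ R') (hR'R : R' < R)
    (hlam₀ : ∀ t, t ≤ s₁ → lam t = 0)
    (hI : ∀ θ x, ρ x < R → ρ (J (θ, x)) = ρ x ∧ p (J (θ, x)) = Complex.exp ((θ : ℂ) * I) * p x)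
    (hI0 : ∀ x, ρ x < R → J (0, x) = x) (hIadd : ∀ θ θ' x, ρ x < R → J (θ + θ', x) = J (θ, J (θ', x)))
    (hg0 : ∀ q, g (0, q) = q)
    (hgO : ∀ θ q, s₀ < ρ q → ‖p q‖ < δ → s₀ < ρ (g (θ, q)) ∧ p (g (θ, q)) = Complex.exp ((θ : ℂ) * I) * p q)
    (hgadd : ∀ θ θ' q, s₀ < ρ q → ‖p q‖ < δ → g (θ + θ', q) = g (θ, g (θ', q)))
    (hgρ : ∀ θ q, s₀ < ρ q → ‖p q‖ < δ → ρ q < R → ρ (g (θ, q)) = ρ q)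
    (u : ℝ) {x' : M} (hx' : ‖p x'‖ < δ) :
    (fun x : M => if ρ x ≤ R' then
        g (2 * π * u * lam (ρ x), J (2 * π * u * (1 - lam (ρ x)), x)) else g (2 * π * u, x))
      (if ρ x' ≤ R' then J (-(2 * π * u * (1 - lam (ρ x'))), g (-(2 * π * u * lam (ρ x')), x'))
        else g (-(2 * π * u), x')) = x' := by
  have hs₀R : s₀ < R := by linarith
  by_cases hxR' : ρ x' ≤ R'
  · have hxR : ρ x' < R := lt_of_le_of_lt hxR' hR'R
    rw [if_pos hxR']
    by_cases hx₁ : ρ x' ≤ s₁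
    · -- deep inside: only the model turns
      have hlam : lam (ρ x') = 0 := hlam₀ _ hx₁
      obtain ⟨hρz, -⟩ := hI (-(2 * π * u)) x' hxR
      have hz : J (-(2 * π * u * (1 - lam (ρ x'))), g (-(2 * π * u * lam (ρ x')), x')) = J (-(2 * π * u), x') := by
        rw [hlam, mul_zero, neg_zero, hg0, sub_zero, mul_one]
      dsimp only
      rw [hz, if_pos (hρz.le.trans hxR'), hρz, hlam, mul_zero, hg0, sub_zero, mul_one, ← hIadd _ _ x' hxR,
        add_neg_cancel, hI0 x' hxR]
    · have hx₁ : s₁ < ρ x' := not_le.1 hx₁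
      have hxO : s₀ < ρ x' := hs₀₁.trans_lt hx₁
      obtain ⟨hzO, hpz⟩ := hgO (-(2 * π * u * lam (ρ x'))) x' hxO hx'
      have hρz : ρ (g (-(2 * π * u * lam (ρ x')), x')) = ρ x' := hgρ _ x' hxO hx' hxR
      have hzR : ρ (g (-(2 * π * u * lam (ρ x')), x')) < R := by rw [hρz]; exact hxR
      obtain ⟨hρw, -⟩ := hI (-(2 * π * u * (1 - lam (ρ x')))) _ hzR
      dsimp only
      rw [if_pos ((hρw.trans hρz).le.trans hxR'), hρw, hρz, ← hIadd _ _ _ hzR, add_neg_cancel, hI0 _ hzR,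
        ← hgadd _ _ x' hxO hx', add_neg_cancel, hg0]
  · have hxR' : R' < ρ x' := not_le.1 hxR'
    have hxO : s₀ < ρ x' := by linarith
    rw [if_neg (not_le.2 hxR')]
    have hρz : R' < ρ (g (-(2 * π * u), x')) := by
      by_cases hxR : ρ x' < R
      · rw [hgρ _ x' hxO hx' hxR]; exact hxR'
      · exact lt_of_lt_of_le hR'R (le_ρ_outside_of_le hs₀R hgO hgadd hg0 hgρ hx' (not_lt.1 hxR) _)
    dsimp only
    rw [if_neg (not_le.2 hρz), ← hgadd _ _ x' hxO hx', add_neg_cancel, hg0]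

/-! ### The homotopy between `h(1, ·)` and the model on the fibre-ball -/

/-- **Continuity of the homotopy** `H(s, x) = g(2πsλ(ρx), I(2π(1 − sλ(ρx)), x))` on `ℝ × {ρ < R}`.
[cite: ArnoldGuseinzadeVarchenko2012, Part I §1.1 (held text p0013)] -/
theorem continuousOn_shellHomotopy [TopologicalSpace M] (hp : Continuous ρ) (hlam : Continuous lam)
    (hIcont : ContinuousOn J (univ ×ˢ {x | ρ x < R})) (hgcont : Continuous g) :
    ContinuousOn (fun sx : ℝ × M => g (2 * π * sx.1 * lam (ρ sx.2), J (2 * π * (1 - sx.1 * lam (ρ sx.2)), sx.2)))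
      (univ ×ˢ {x | ρ x < R}) := by
  have hang₁ : Continuous fun sx : ℝ × M => 2 * π * sx.1 * lam (ρ sx.2) :=
    (continuous_const.mul continuous_fst).mul (hlam.comp (hp.comp continuous_snd))
  have hang₂ : Continuous fun sx : ℝ × M => 2 * π * (1 - sx.1 * lam (ρ sx.2)) :=
    continuous_const.mul (continuous_const.sub (continuous_fst.mul (hlam.comp (hp.comp continuous_snd))))
  have hIin : ContinuousOn (fun sx : ℝ × M => J (2 * π * (1 - sx.1 * lam (ρ sx.2)), sx.2)) (univ ×ˢ {x | ρ x < R}) :=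
    hIcont.comp (hang₂.continuousOn.prodMk continuousOn_snd) fun sx hsx => ⟨mem_univ _, hsx.2⟩
  exact hgcont.comp_continuousOn (hang₁.continuousOn.prodMk hIin)

/-- **The homotopy runs through self-maps of each fibre-ball**: for `‖p x‖ < δ`, `ρ x < R`:
`p (H(s, x)) = p x` (total angle `2π`) and `ρ (H(s, x)) = ρ x`; `H(0, x) = I(2π, x)`; and `H(1, x) = h(1, x)` when
`ρ x ≤ R'`. [cite: ArnoldGuseinzadeVarchenko2012, Part I §1.1 (held text p0013, p0025)] [cite: Milnor1968, §9 Lemma 9.4] -/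
theorem apply_shellHomotopy (hs₀₁ : s₀ ≤ s₁) (hlam₀ : ∀ t, t ≤ s₁ → lam t = 0)
    (hI : ∀ θ x, ρ x < R → ρ (J (θ, x)) = ρ x ∧ p (J (θ, x)) = Complex.exp ((θ : ℂ) * I) * p x)
    (hg0 : ∀ q, g (0, q) = q)
    (hgO : ∀ θ q, s₀ < ρ q → ‖p q‖ < δ → s₀ < ρ (g (θ, q)) ∧ p (g (θ, q)) = Complex.exp ((θ : ℂ) * I) * p q)
    (hgρ : ∀ θ q, s₀ < ρ q → ‖p q‖ < δ → ρ q < R → ρ (g (θ, q)) = ρ q)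
    (s : ℝ) {x : M} (hx : ‖p x‖ < δ) (hxR : ρ x < R) :
    p (g (2 * π * s * lam (ρ x), J (2 * π * (1 - s * lam (ρ x)), x))) = p x ∧
      ρ (g (2 * π * s * lam (ρ x), J (2 * π * (1 - s * lam (ρ x)), x))) = ρ x ∧
      g (2 * π * (0 : ℝ) * lam (ρ x), J (2 * π * (1 - (0 : ℝ) * lam (ρ x)), x)) = J (2 * π, x) ∧
      (ρ x ≤ R' → g (2 * π * (1 : ℝ) * lam (ρ x), J (2 * π * (1 - (1 : ℝ) * lam (ρ x)), x)) =
        (if ρ x ≤ R' then g (2 * π * (1 : ℝ) * lam (ρ x), J (2 * π * (1 : ℝ) * (1 - lam (ρ x)), x))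
          else g (2 * π * (1 : ℝ), x))) := by
  obtain ⟨hρy, hpy⟩ := hI (2 * π * (1 - s * lam (ρ x))) x hxR
  refine ⟨?_, ?_, by simp only [mul_zero, zero_mul, sub_zero, mul_one, hg0], fun hxR' => by
    simp only [if_pos hxR', one_mul, mul_one]⟩
  · by_cases hx₁ : ρ x ≤ s₁
    · have hlam : lam (ρ x) = 0 := hlam₀ _ hx₁
      simp only [hlam, mul_zero, sub_zero, mul_one, hg0] at hpy ⊢
      rw [hpy, show ((2 * π : ℝ) : ℂ) * I = 2 * π * I by push_cast; ring, Complex.exp_two_pi_mul_I, one_mul]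
    · have hx₁ : s₁ < ρ x := not_le.1 hx₁
      have hyO : s₀ < ρ (J (2 * π * (1 - s * lam (ρ x)), x)) := by rw [hρy]; exact hs₀₁.trans_lt hx₁
      have hpy' : ‖p (J (2 * π * (1 - s * lam (ρ x)), x))‖ < δ := by rw [hpy, norm_exp_mul_I_mul]; exact hx
      obtain ⟨-, hpg⟩ := hgO (2 * π * s * lam (ρ x)) _ hyO hpy'
      rw [hpg, hpy, exp_mul_I_add_mul]
      rw [show ((2 * π * s * lam (ρ x) + 2 * π * (1 - s * lam (ρ x)) : ℝ) : ℂ) * I = 2 * π * I by push_cast; ring,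
        Complex.exp_two_pi_mul_I, one_mul]
  · by_cases hx₁ : ρ x ≤ s₁
    · have hlam : lam (ρ x) = 0 := hlam₀ _ hx₁
      simp only [hlam, mul_zero, sub_zero, mul_one, hg0] at hρy ⊢
      exact hρy
    · have hx₁ : s₁ < ρ x := not_le.1 hx₁
      have hyO : s₀ < ρ (J (2 * π * (1 - s * lam (ρ x)), x)) := by rw [hρy]; exact hs₀₁.trans_lt hx₁
      have hpy' : ‖p (J (2 * π * (1 - s * lam (ρ x)), x))‖ < δ := by rw [hpy, norm_exp_mul_I_mul]; exact hx
      have hyR : ρ (J (2 * π * (1 - s * lam (ρ x)), x)) < R := by rw [hρy]; exact hxR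
      rw [hgρ _ _ hyO hpy' hyR, hρy]

end Shell

end Literature.Geometry.Manifold

end
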